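import Summits.CriticalPhenomena.PercolationContinuityZ3.Theorems.PercNearOneGluingNoHeavyLowerTailTypedReductions
import Summits.CriticalPhenomena.PercolationContinuityZ3.Theorems.PercNearOneGluingNoHeavyLowerTailAdditiveStepResidual
import Summits.CriticalPhenomena.PercolationContinuityZ3.Theorems.PercNearOneGluingNearOneGluingVariants2455
import HarnessLib

/-!
# `NoHeavyLowerTail` (stmt-CriticalPhenomena-4575), lines `additive-shortening` / `common-relay-interpolation`:
# the open kernel typed exactly — the BAD-OBSERVER glue step with at least three relays

Route task `nh-dp-commonrelay` (prover-prim-nh-dp-commonrelay-0, 2026-08-18).  The registered stub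
`stub_additiveShorteningStep` (additive form of Kozma–Nitzan's Conjecture 6, arXiv:2401.12397 §5.3: glue the
pair `s(v,x)` at the observer `v` and keep the minimiser `a₀` of the UNGLUED graph) is already a theorem on
three faces, all landed in the tree:

* `|A| ≤ 2` — `knConj6Two_glued` (KN Conjecture 6 for two relays, BHK 2006 Thm 1.5 twice) and the one-relay
  union bound;
* `μ(a₀ ↔ b) ≤ μ(x ↔ b)` — `additiveStep_of_le_partner`;
* `μ(a₀ ↔ b) ≤ μ(v ↔ b)` — `additiveStep_of_le_source`.

What is left is the **bad-observer kernel**: `3 ≤ |A|` and BOTH endpoints of the glued pair strictly less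
reliable than the minimiser, `μ(v ↔ b) < μ(a₀ ↔ b)`, `μ(x ↔ b) < μ(a₀ ↔ b)` (so `v, x, b ∉ A` up to null
cases) — exactly the regime of Conjecture 3 itself, where the observer is the worst-connected vertex.  This
file states that kernel verbatim (same binders as the stub plus the three extra hypotheses) and proves

* `additiveShorteningStep_of_badObserverKernel` : kernel ⇒ `stub_additiveShorteningStep` (statement verbatim);
* `noHeavyLowerTail_of_badObserverKernel` : kernel ⇒ the crux, through the landed
  `noHeavyLowerTail_of_additiveShorteningStep` (Lemma-13-type induction ⇒ additive Conjecture 1 ⇒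
  `AdditiveGluing` ⇒ `NearOneGluing` ⇒ residual ⇒ `NoHeavyLowerTail`).

Numerical status of the kernel (exact enumeration, item evidence COMMON-RELAY-FINDINGS.md / compute job
glue-step-census): 0 violations, and it holds in the stronger pre-FKG form
`μ₁(v ↔ b, v ↔ A∖a₀, v ↮ a₀) ≥ μ₁(a₀ ↔ b, v ↔ A∖a₀, v ↮ a₀)` (Kozma–Nitzan Question 7 after gluing).
No new definitions, no named facts; bookkeeping only.
-/

noncomputable section

namespace Summit.CriticalPhenomena.PercolationContinuityZ3.Theorems

open MeasureTheory Set Literature.Probability.LatticeModels Literature.Probability.Percolation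
open Summit.CriticalPhenomena.PercolationContinuityZ3.Theses.PercNearOneGluing
open scoped Classical BigOperators

/-- **One relay**: if every element of `A` equals `a₀ ∈ A`, the additive step is the union bound
`{v ↔ a₀} ⊆ {v ↔ b} ∪ {a₀ ↔ b}ᶜ` (in any weight function, here the glued one). [folklore] -/
theorem additiveStep_of_relays_eq {n : ℕ} (w' : Sym2 (Fin n) → unitInterval) (A : Finset (Fin n))
    (b v a₀ : Fin n) (hA : ∀ a ∈ A, a = a₀) :
    (prodBernoulli w').real (⋃ a ∈ A, openConn v a) - (1 - (prodBernoulli w').real (openConn a₀ b)) ≤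
      (prodBernoulli w').real (openConn v b) := by
  set μ := prodBernoulli w' with hμ
  have mem : ∀ (ω : BondConfig (Fin n)) (p q : Fin n),
      ω ∈ (openConn p q : Set (BondConfig (Fin n))) ↔ (openGraph ω).Reachable p q := fun _ _ _ => Iff.rfl
  have hsub : (⋃ a ∈ A, openConn v a : Set (BondConfig (Fin n))) ⊆ openConn v b ∪ (openConn a₀ b)ᶜ := by
    intro ω hω
    simp only [mem_iUnion, exists_prop] at hω
    obtain ⟨a, ha, hva⟩ := hω
    rw [hA a ha] at hva
    by_cases hab : ω ∈ (openConn a₀ b : Set (BondConfig (Fin n)))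
    · exact Or.inl ((mem ω v a₀).1 hva |>.trans ((mem ω a₀ b).1 hab))
    · exact Or.inr hab
  have h1 : μ.real (⋃ a ∈ A, openConn v a) ≤ μ.real (openConn v b) + μ.real (openConn a₀ b)ᶜ :=
    (measureReal_mono hsub).trans (measureReal_union_le _ _)
  have h2 : μ.real (openConn a₀ b)ᶜ = 1 - μ.real (openConn a₀ b) :=
    probReal_compl_eq_one_sub MeasurableSet.of_discrete
  linarith

/-- **Two relays or fewer**: the additive step for `A.card ≤ 2` — from `knConj6Two_glued`
(Kozma–Nitzan Conjecture 6 for two relays, proved in the tree) via `yz ≥ y + z − 1`, and from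
`additiveStep_of_relays_eq` when `A = {a₀}`. -/
theorem additiveStep_of_card_le_two {n : ℕ} (w : Sym2 (Fin n) → unitInterval) (A : Finset (Fin n))
    (b v x a₀ : Fin n) (hcard : A.card ≤ 2) (hvx : v ≠ x) (ha₀ : a₀ ∈ A)
    (hmin : ∀ a ∈ A, (prodBernoulli w).real (openConn a₀ b) ≤ (prodBernoulli w).real (openConn a b)) :
    (prodBernoulli (Function.update w s(v, x) 1)).real (⋃ a ∈ A, openConn v a) -
        (1 - (prodBernoulli (Function.update w s(v, x) 1)).real (openConn a₀ b)) ≤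
      (prodBernoulli (Function.update w s(v, x) 1)).real (openConn v b) := by
  by_cases h : ∃ a ∈ A, a ≠ a₀
  · obtain ⟨a₁, ha₁, hne⟩ := h
    have hA : ∀ a ∈ A, a = a₀ ∨ a = a₁ := by
      intro a ha
      by_contra hcon
      push Not at hcon
      have h3 : 2 < A.card :=
        Finset.two_lt_card.2 ⟨a₀, ha₀, a₁, ha₁, a, ha, hne.symm, fun h' => hcon.1 h'.symm,
          fun h' => hcon.2 h'.symm⟩
      omega
    exact additiveStep_of_multiplicativeStep _ A b v a₀
      (knConj6Two_glued w A b v x a₀ a₁ hvx hne.symm hA (hmin a₁ ha₁))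
  · push Not at h
    exact additiveStep_of_relays_eq _ A b v a₀ h

/-- **The bad-observer kernel ⇒ `stub_additiveShorteningStep` (statement verbatim).**  The kernel is the
registered stub with three extra hypotheses: `3 ≤ A.card`, `μ_w(v ↔ b) < μ_w(a₀ ↔ b)`,
`μ_w(x ↔ b) < μ_w(a₀ ↔ b)`.  Every other case is a landed theorem (`additiveStep_of_card_le_two`,
`additiveStep_of_le_source`, `additiveStep_of_le_partner`). -/
theorem additiveShorteningStep_of_badObserverKernel : (∀ (n : ℕ) (w : Sym2 (Fin n) → unitInterval) (A : Finset (Fin n)) (b v x a₀ : Fin n), 3 ≤ A.card → v ∉ A → v ≠ x → w s(v, x) = 0 → a₀ ∈ A → (∀ a ∈ A, (prodBernoulli w).real (openConn a₀ b) ≤ (prodBernoulli w).real (openConn a b)) → (prodBernoulli w).real (openConn v b) < (prodBernoulli w).real (openConn a₀ b) → (prodBernoulli w).real (openConn x b) < (prodBernoulli w).real (openConn a₀ b) → (∀ w' : Sym2 (Fin n) → unitInterval, (∀ e, w e = 0 → w' e = 0) → ∀ (A' : Finset (Fin n)) (o' b' : Fin n) (t : ℝ), A'.Nonempty → (∀ a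 ∈ A', t ≤ (prodBernoulli w').real (openConn a b')) → (prodBernoulli w').real (⋃ a ∈ A', openConn o' a) - (1 - t) ≤ (prodBernoulli w').real (openConn o' b')) → (prodBernoulli (Function.update w s(v, x) 1)).real (⋃ a ∈ A, openConn v a) - (1 - (prodBernoulli (Function.update w s(v, x) 1)).real (openConn a₀ b)) ≤ (prodBernoulli (Function.update w s(v, x) 1)).real (openConn v b)) → ∀ (n : ℕ) (w : Sym2 (Fin n) → unitInterval) (A : Finset (Fin n)) (b v x a₀ : Fin n), v ∉ A → v ≠ x → w s(v, x) = 0 → a₀ ∈ A → (∀ a ∈ A, (prodBernoulli w).real (openConn a₀ b) ≤ (prodBernoulli w).real (openConn a b)) → (∀ w' : Sym2 (Fin n) → unitInterval, (∀ e, w e = 0 → w' e = 0) → ∀ (A' : Finset (Fin n)) (o' b' : Fin n) (t : ℝ), A'.Nonempty → (∀ a ∈ A', t ≤ (prodBernoulli w').real (openConn a b')) → (prodBernoulli w').real (⋃ a ∈ A', openConn o' a) - (1 - t) ≤ (prodBernoulli w').real (openConn o' b')) → (prodBernoulli (Function.update w s(v, x) 1)).real (⋃ a ∈ A, openConn v a)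 - (1 - (prodBernoulli (Function.update w s(v, x) 1)).real (openConn a₀ b)) ≤ (prodBernoulli (Function.update w s(v, x) 1)).real (openConn v b) := by
  intro hK n w A b v x a₀ hvA hvx hw0 ha₀ hmin hIH
  by_cases hcard : A.card ≤ 2
  · exact additiveStep_of_card_le_two w A b v x a₀ hcard hvx ha₀ hmin
  by_cases hv : (prodBernoulli w).real (openConn a₀ b) ≤ (prodBernoulli w).real (openConn v b)
  · exact additiveStep_of_le_source n w A b v x a₀ hvx hv
  by_cases hx : (prodBernoulli w).real (openConn a₀ b) ≤ (prodBernoulli w).real (openConn x b)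
  · exact additiveStep_of_le_partner n w A b v x a₀ hvx hx
  push Not at hcard hv hx
  exact hK n w A b v x a₀ (by omega) hvA hvx hw0 ha₀ hmin hv hx hIH

/-- **The bad-observer kernel ⇒ the crux `NoHeavyLowerTail`**, through the landed chain
`noHeavyLowerTail_of_additiveShorteningStep` (step ⇒ additive Conjecture 1 by `stub_additiveLemma13` ⇒
`AdditiveGluing` ⇒ `NearOneGluing` ⇒ residual ⇒ crux). -/
theorem noHeavyLowerTail_of_badObserverKernel : (∀ (n : ℕ) (w : Sym2 (Fin n) → unitInterval) (A : Finset (Fin n)) (b v x a₀ : Fin n), 3 ≤ A.card → v ∉ A → v ≠ x → w s(v, x) = 0 → a₀ ∈ A → (∀ a ∈ A, (prodBernoulli w).real (openConn a₀ b) ≤ (prodBernoulli w).real (openConn a b)) → (prodBernoulli w).real (openConn v b) < (prodBernoulli w).real (openConn a₀ b) → (prodBernoulli w).real (openConn x b) < (prodBernoulli w).real (openConn a₀ b) → (∀ w' : Sym2 (Fin n) → unitInterval, (∀ e, w e = 0 → w' e = 0) → ∀ (A' : Finset (Fin n)) (o' b' : Fin n) (t : ℝ), A'.Nonempty → (∀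 a ∈ A', t ≤ (prodBernoulli w').real (openConn a b')) → (prodBernoulli w').real (⋃ a ∈ A', openConn o' a) - (1 - t) ≤ (prodBernoulli w').real (openConn o' b')) → (prodBernoulli (Function.update w s(v, x) 1)).real (⋃ a ∈ A, openConn v a) - (1 - (prodBernoulli (Function.update w s(v, x) 1)).real (openConn a₀ b)) ≤ (prodBernoulli (Function.update w s(v, x) 1)).real (openConn v b)) → NoHeavyLowerTail := fun hK =>
  noHeavyLowerTail_of_additiveShorteningStep (additiveShorteningStep_of_badObserverKernel hK)

end Summit.CriticalPhenomena.PercolationContinuityZ3.Theorems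

end
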